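import Literature.GroupTheory.TwoSheetAnnihilator
import HarnessLib

/-!
# The four-sheet annihilator lemma: Fourier analysis on an abelian normal subgroup with cyclic quotient of order four

COR-CM (cell `pub-hodgecm2`), binder seat b04 (gen 26), count-neutral — groundwork for the gen-26 FRONTIER «metacyclic groups
`C_p ⋊_r C_{2^m}` with an action of ORDER FOUR» (A7-JUNCTION gen-26 addendum §C): the `n = 4` analogue of gen 20's
`CorCM/TwoSheetAnnihilator` (`n = 2`).  Pure finite-group harmonic analysis (Mathlib + `TwoSheetAnnihilator` §1–§2 only):
theorems, no definition, no named fact, no `sorry`.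

SETTING.  `A` a finite abelian group, `θ ∈ Aut A` with `θ⁴ = 1` (conjugation by `x`, `x⁴ = q ∈ A`, `θ q = q`), an involution
`c` fixed by `θ`; a weight `b` on `G = ⊔_{l<4} A x^l` is four SHEETS `β_l(u) = b(u x^l)`, a set `S ⊆ G` is four sheets
`S_j = {t : t x^j ∈ S}`, and the annihilator equations `Σ_{s∈S} b(s g) = 0` at `g = w x^i` read
  `E_i(w) : Σ_{j<4} Σ_{t∈S_j} β_{(i+j) mod 4}(t · θ^j(w) · q^{[i+j ≥ 4]}) = 0`.
FOURIER TRANSFORM (`B_m(ψ) = Σ_v ψ(v⁻¹) β_m(v)`, `Ŝ_j(ψ) = Σ_{t∈S_j} ψ(t)`): weighting `E_i` with the character `χ ∘ θ^{−(i−δ)}`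
gives, for each odd `χ` and each `δ ∈ ℤ/4`, the `4 × 4` system
  `Σ_{j<4} χ(q)^{[i+j≥4]} · Ŝ_j(χ ∘ θ^{−τ}) · u_τ = 0` (`i < 4`), `τ = (i + j − δ) mod 4`, `u_τ = B_{(τ+δ) mod 4}(χ ∘ θ^{−τ})`
— a twisted circulant: left multiplication by `Σ_j Ŝ_j Y^j` in the cyclic algebra `(L/L₀, σ, χ(q))` (gen-26 addendum).  If
each such system forces `u_0 = 0`, then `B_δ(χ) = 0` for all odd `χ` and all `δ`, so every sheet vanishes
(`TwoSheet.eq_zero_of_antisymm_of_forall_odd`).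

* §1 `character_sum_twist_aut` (`Σ_w χ(w⁻¹) g(t φ(w)) = χ(φ⁻¹t) · Σ_v χ((φ⁻¹v)⁻¹) g(v)` for `φ ∈ Aut A`), `inv_pow_mod_four`,
  `inv_pow_fix`.
* §2 **`fourSheet_eq_zero`** — the four-sheet lemma (Fourier form, hypothesis = injectivity of the systems on `u_0`).
* §3 GROUP FORM: `pow_mul_eq`, `aut_pow_four`, `aut_fix`, `sum_eq_sum_sheets_four`, **`eq_zero_of_fourSheet`** — `i : A →* G`
  injective, `G = ⊔_{l<4} i(A)x^l`, `x i(u) = i(θu) x`, `x⁴ = i(q)`: every `i(c)`-antisymmetric `b : G → ℚ` annihilated by the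
  right translates of `S` is zero (the input of gen 20's `GaloisRank.isNondegenerate_iff_forall_annihilator`).

## References

* [Kubota1965] T. Kubota, *On the field extension by complex multiplication*, Trans. AMS 118 (1965), §4 Lemma 2.
* [Dodson1987] B. Dodson, J. Algebra 111 (1987), §1.1 (the rank via translates).

Provenance: Literature home (namespace `Literature.GroupTheory.FourSheet`) of the Summits-side `CorCM/FourSheetAnnihilator` (cell `pub-hodgecm2`, COR-CM; all its imports are `Literature/`, Mathlib and the already re-homed `TwoSheetAnnihilator`), which `Literature/` may not import; theorems only, no named fact, no definition. Nothing here bears on `HC_CM`. Lane `lit-hodgefound` (Layer A3: CM types, their Kubota ranks and Galois combinatorics), seat p20.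
-/

noncomputable section

open scoped BigOperators

namespace Literature.GroupTheory.FourSheet

open Literature.GroupTheory.TwoSheet

open AddChar
open Literature.GroupTheory.TwoSheet (character_sum_shift eq_zero_of_antisymm_of_forall_odd)

variable {A : Type*} [CommGroup A] [Fintype A] [DecidableEq A]

/-! ## §1 Twisted character sums along an automorphism -/

omit [DecidableEq A] in
/-- **`Σ_w χ(w⁻¹) g(t φ(w)) = χ(φ⁻¹ t) · Σ_v χ((φ⁻¹ v)⁻¹) g(v)`** for `φ ∈ Aut A` (substitute `w = φ⁻¹ v t⁻¹`). [cite: Kubota1965, §4 Lemma 2] -/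
theorem character_sum_twist_aut (χ : AddChar (Additive A) ℂ) (φ : MulAut A) (g : A → ℂ) (t : A) :
    ∑ w, χ (Additive.ofMul w⁻¹) * g (t * φ w) =
      χ (Additive.ofMul (φ⁻¹ t)) * ∑ v, χ (Additive.ofMul (φ⁻¹ v)⁻¹) * g v := by
  -- substitute `w = φ⁻¹ w'`
  have e1 : ∑ w, χ (Additive.ofMul w⁻¹) * g (t * φ w) = ∑ w', χ (Additive.ofMul (φ⁻¹ w')⁻¹) * g (t * w') := by
    refine (Fintype.sum_equiv φ.toEquiv (fun w => χ (Additive.ofMul w⁻¹) * g (t * φ w))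
      (fun w' => χ (Additive.ofMul (φ⁻¹ w')⁻¹) * g (t * w')) fun w => ?_)
    simp
  -- the twisted character `χ ∘ φ⁻¹`
  let χφ : AddChar (Additive A) ℂ := χ.compAddMonoidHom (MonoidHom.toAdditive (φ⁻¹).toMonoidHom)
  have hχφ : ∀ u : A, χφ (Additive.ofMul u) = χ (Additive.ofMul (φ⁻¹ u)) := fun u => rfl
  rw [e1]
  have e2 := character_sum_shift χφ g t
  simp only [hχφ, map_inv] at e2 ⊢
  exact e2

omit [Fintype A] [DecidableEq A] in
/-- `(θ⁻¹)^n = (θ⁻¹)^{n mod 4}` when `θ⁴ = 1`. [cite: Kubota1965, §4 Lemma 2] -/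
theorem inv_pow_mod_four (θ : MulAut A) (hθ4 : θ ^ 4 = 1) (n : ℕ) : θ⁻¹ ^ n = θ⁻¹ ^ (n % 4) := by
  have h4 : θ⁻¹ ^ 4 = 1 := by rw [inv_pow, hθ4, inv_one]
  conv_lhs => rw [← Nat.div_add_mod n 4, pow_add, pow_mul, h4, one_pow, one_mul]

omit [Fintype A] [DecidableEq A] in
/-- Powers of `θ⁻¹` fix every `θ`-fixed element. [cite: Kubota1965, §4 Lemma 2] -/
theorem inv_pow_fix (θ : MulAut A) {q : A} (hθq : θ q = q) (n : ℕ) : (θ⁻¹ ^ n) q = q := by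
  have h1 : θ⁻¹ q = q := by
    rw [MulAut.inv_apply, MulEquiv.symm_apply_eq]; exact hθq.symm
  induction n with
  | zero => simp
  | succ n ih => rw [pow_succ, MulAut.mul_apply, h1, ih]

omit [Fintype A] [DecidableEq A] in
/-- `(θ^j)⁻¹ = (θ⁻¹)^j`-twists compose: `(θ⁻¹)^s ((θ^j)⁻¹ y) = (θ⁻¹)^{s+j} y`. [cite: Kubota1965, §4 Lemma 2] -/
theorem inv_pow_apply_pow_inv (θ : MulAut A) (s j : ℕ) (y : A) : (θ⁻¹ ^ s) ((θ ^ j)⁻¹ y) = (θ⁻¹ ^ (s + j)) y := by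
  rw [← inv_pow, ← MulAut.mul_apply, ← pow_add]

/-! ## §2 The four-sheet lemma -/

/-- **THE FOUR-SHEET LEMMA.**  Data on a finite abelian group `A`: an involution `c`, an automorphism `θ` with `θ⁴ = 1`
fixing `c` and `q`; four sheets `β_0, …, β_3 : A → ℂ`, each `c`-antisymmetric, and four finite sets `S_0, …, S_3` solving the
FOUR-SHEET SYSTEM `Σ_{j<4} Σ_{t∈S_j} β_{(i+j) mod 4}(t · θ^j(w) · q^{[i+j≥4]}) = 0` (`i < 4`, `w ∈ A`).  If for every ODD character
`χ` and every `δ < 4` the transformed `4 × 4` system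
`Σ_{j<4} χ(q)^{[i+j≥4]} · (Σ_{t∈S_j} χ(θ^{−τ} t)) · u_τ = 0` (`i < 4`; `τ = (i + j − δ) mod 4`) forces `u_0 = 0`, then all four
sheets vanish. [cite: Kubota1965, §4 Lemma 2] -/
theorem fourSheet_eq_zero {c q : A} (hcc : c * c = 1) (θ : MulAut A) (hθ4 : θ ^ 4 = 1) (hθq : θ q = q)
    (S : ℕ → Finset A) (β : ℕ → A → ℂ) (hβ : ∀ l u, β l (c * u) = -β l u)
    (hsys : ∀ i, i < 4 → ∀ w : A,
      ∑ j ∈ Finset.range 4, ∑ t ∈ S j, β ((i + j) % 4) (t * (θ ^ j) w * (if i + j < 4 then 1 else q)) = 0)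
    (hinj : ∀ χ : AddChar (Additive A) ℂ, χ (Additive.ofMul c) = -1 → ∀ δ, δ < 4 → ∀ u : ℕ → ℂ,
      (∀ i, i < 4 → ∑ j ∈ Finset.range 4, (if i + j < 4 then (1 : ℂ) else χ (Additive.ofMul q)) *
        (∑ t ∈ S j, χ (Additive.ofMul ((θ⁻¹ ^ ((i + j + 4 - δ) % 4)) t))) * u ((i + j + 4 - δ) % 4) = 0) →
      u 0 = 0) :
    ∀ m, m < 4 → β m = 0 := by
  intro m hm
  refine eq_zero_of_antisymm_of_forall_odd hcc (β m) (hβ m) fun χ hχ => ?_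
  -- the unknowns `u_τ = B_{(τ+m) mod 4}(χ ∘ θ^{−τ})`
  set u : ℕ → ℂ := fun τ => ∑ v, χ (Additive.ofMul ((θ⁻¹ ^ τ) v)⁻¹) * β ((τ + m) % 4) v with hu_def
  have hu0 : u 0 = ∑ v, β m v * χ (Additive.ofMul v⁻¹) := by
    simp only [hu_def, pow_zero, MulAut.one_apply, zero_add, Nat.mod_eq_of_lt hm]
    exact Finset.sum_congr rfl fun v _ => mul_comm _ _
  rw [← hu0]
  refine hinj χ hχ m hm u fun i hi => ?_
  -- weight `E_i` with the character `ψ = χ ∘ θ^{−s}`, `s = (i + 4 − m) mod 4`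
  set s : ℕ := (i + 4 - m) % 4 with hs_def
  let ψ : AddChar (Additive A) ℂ := χ.compAddMonoidHom (MonoidHom.toAdditive (θ⁻¹ ^ s).toMonoidHom)
  have hψ : ∀ y : A, ψ (Additive.ofMul y) = χ (Additive.ofMul ((θ⁻¹ ^ s) y)) := fun y => rfl
  have h := congrArg (fun F : A → ℂ => ∑ w, ψ (Additive.ofMul w⁻¹) * F w) (funext (hsys i hi))
  simp only [mul_zero, Finset.sum_const_zero, Finset.mul_sum] at h
  rw [Finset.sum_comm] at h
  -- each `(j, t)`-term is a twisted shift of `β_{(i+j) mod 4}`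
  have key : ∀ j ∈ Finset.range 4,
      ∑ w, ∑ t ∈ S j, ψ (Additive.ofMul w⁻¹) * β ((i + j) % 4) (t * (θ ^ j) w * (if i + j < 4 then 1 else q)) =
        (if i + j < 4 then (1 : ℂ) else χ (Additive.ofMul q)) *
          (∑ t ∈ S j, χ (Additive.ofMul ((θ⁻¹ ^ ((i + j + 4 - m) % 4)) t))) * u ((i + j + 4 - m) % 4) := by
    intro j hj
    rw [Finset.mem_range] at hj
    rw [Finset.sum_comm]
    have hτ : (s + j) % 4 = (i + j + 4 - m) % 4 := by rw [hs_def]; omega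
    have hidx : ((i + j + 4 - m) % 4 + m) % 4 = (i + j) % 4 := by omega
    have hterm : ∀ t : A, ∑ w, ψ (Additive.ofMul w⁻¹) * β ((i + j) % 4) (t * (θ ^ j) w * (if i + j < 4 then 1 else q)) =
        (if i + j < 4 then (1 : ℂ) else χ (Additive.ofMul q)) * χ (Additive.ofMul ((θ⁻¹ ^ ((i + j + 4 - m) % 4)) t)) *
          u ((i + j + 4 - m) % 4) := fun t => by
      have e1 : ∀ w, t * (θ ^ j) w * (if i + j < 4 then 1 else q) = (t * (if i + j < 4 then 1 else q)) * (θ ^ j) w :=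
        fun w => mul_right_comm _ _ _
      simp_rw [e1]
      rw [character_sum_twist_aut ψ (θ ^ j) (β ((i + j) % 4)) _, hψ, inv_pow_apply_pow_inv, inv_pow_mod_four θ hθ4, hτ,
        map_mul, ofMul_mul, map_add_eq_mul, hu_def]
      simp only
      rw [hidx]
      have hq' : χ (Additive.ofMul ((θ⁻¹ ^ ((i + j + 4 - m) % 4)) (if i + j < 4 then 1 else q))) =
          (if i + j < 4 then (1 : ℂ) else χ (Additive.ofMul q)) := by
        split_ifs with hlt
        · rw [map_one, ofMul_one, map_zero_eq_one]
        · rw [inv_pow_fix θ hθq]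
      rw [hq']
      have hin : ∀ v : A, ψ (Additive.ofMul ((θ ^ j)⁻¹ v)⁻¹) = χ (Additive.ofMul ((θ⁻¹ ^ ((i + j + 4 - m) % 4)) v)⁻¹) :=
        fun v => by
        rw [← map_inv, hψ, inv_pow_apply_pow_inv, inv_pow_mod_four θ hθ4, hτ, map_inv]
      simp_rw [hin]
      ring
    simp_rw [hterm, ← Finset.sum_mul, ← Finset.mul_sum]
  rw [Finset.sum_congr rfl key] at h
  exact h

/-! ## §3 Group form: an abelian normal subgroup with cyclic quotient of order four -/

section Group

variable {G : Type*} [Group G] [Fintype G] [DecidableEq G]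

omit [Fintype A] [DecidableEq A] [Fintype G] [DecidableEq G] in
/-- `x^n i(u) = i(θ^n u) x^n`. [cite: Kubota1965, §4 Lemma 2] -/
theorem pow_mul_eq (i : A →* G) (x : G) (θ : MulAut A) (hθ : ∀ u, x * i u = i (θ u) * x) (n : ℕ) (u : A) :
    x ^ n * i u = i ((θ ^ n) u) * x ^ n := by
  induction n generalizing u with
  | zero => simp
  | succ n ih => rw [pow_succ, mul_assoc, hθ, ← mul_assoc, ih, pow_succ, MulAut.mul_apply, mul_assoc]

omit [Fintype A] [DecidableEq A] [Fintype G] [DecidableEq G] in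
/-- `θ⁴ = 1`: `x⁴ = i(q)` centralises `i(A)` (`A` abelian). [cite: Kubota1965, §4 Lemma 2] -/
theorem aut_pow_four (i : A →* G) (hi : Function.Injective i) (x : G) (θ : MulAut A)
    (hθ : ∀ u, x * i u = i (θ u) * x) (q : A) (hq : x ^ 4 = i q) : θ ^ 4 = 1 := by
  ext u
  have h1 := pow_mul_eq i x θ hθ 4 u
  rw [hq, ← map_mul, ← map_mul, mul_comm q] at h1
  have h2 := hi h1
  rw [MulAut.one_apply]
  exact (mul_right_cancel h2).symm

omit [Fintype A] [DecidableEq A] [Fintype G] [DecidableEq G] in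
/-- `θ q = q`. [cite: Kubota1965, §4 Lemma 2] -/
theorem aut_fix (i : A →* G) (hi : Function.Injective i) (x : G) (θ : MulAut A)
    (hθ : ∀ u, x * i u = i (θ u) * x) (q : A) (hq : x ^ 4 = i q) : θ q = q := by
  have h1 : x * i q = i q * x := by rw [← hq, ← pow_succ, ← pow_succ']
  rw [hθ] at h1
  exact hi (mul_right_cancel h1)

omit [DecidableEq A] [DecidableEq G] in
/-- **Sums over `S ⊆ G = ⊔_{l<4} i(A) x^l` split into the four sheets.** [cite: Kubota1965, §4 Lemma 2] -/
theorem sum_eq_sum_sheets_four (i : A →* G) (hi : Function.Injective i) (x : G)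
    (hx : ∀ l, 0 < l → l < 4 → ∀ u, i u ≠ x ^ l) (hcov : ∀ g : G, ∃ l, l < 4 ∧ ∃ u, g = i u * x ^ l)
    (S : Finset G) (Sh : ℕ → Finset A) (hSh : ∀ l, l < 4 → ∀ u, u ∈ Sh l ↔ i u * x ^ l ∈ S)
    {M : Type*} [AddCommMonoid M] (F : G → M) :
    ∑ s ∈ S, F s = ∑ l ∈ Finset.range 4, ∑ u ∈ Sh l, F (i u * x ^ l) := by
  classical
  -- the bijection `Fin 4 × A → G`
  let e : Fin 4 × A → G := fun p => i p.2 * x ^ (p.1 : ℕ)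
  have hinj : Function.Injective e := by
    rintro ⟨l, u⟩ ⟨l', v⟩ h
    change i u * x ^ (l : ℕ) = i v * x ^ (l' : ℕ) at h
    have hll : (l : ℕ) = l' := by
      by_contra hne
      rcases Nat.lt_or_gt_of_ne hne with hlt | hlt
      · -- `x^{l' - l} ∈ i(A)`
        have h2 : i (v⁻¹ * u) = x ^ ((l' : ℕ) - l) := by
          have h3 : i u = i v * x ^ ((l' : ℕ) - l) := by
            have e4 : (l' : ℕ) = ((l' : ℕ) - l) + l := by omega
            rw [e4, pow_add, ← mul_assoc] at h
            exact mul_right_cancel h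
          rw [map_mul, map_inv, h3, inv_mul_cancel_left]
        exact hx _ (by omega) (by omega) _ h2
      · have h2 : i (u⁻¹ * v) = x ^ ((l : ℕ) - l') := by
          have h3 : i v = i u * x ^ ((l : ℕ) - l') := by
            have e4 : (l : ℕ) = ((l : ℕ) - l') + l' := by omega
            rw [e4, pow_add, ← mul_assoc] at h
            exact (mul_right_cancel h).symm
          rw [map_mul, map_inv, h3, inv_mul_cancel_left]
        exact hx _ (by omega) (by omega) _ h2
    have hl : l = l' := Fin.ext hll
    subst hl
    have huv : u = v := hi (mul_right_cancel h)
    rw [huv]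
  have hsurj : Function.Surjective e := fun g => by
    obtain ⟨l, hl, u, rfl⟩ := hcov g
    exact ⟨(⟨l, hl⟩, u), rfl⟩
  have h1 : ∑ s ∈ S, F s = ∑ g : G, if g ∈ S then F g else 0 := (Fintype.sum_ite_mem S F).symm
  rw [h1, ← Fintype.sum_bijective e ⟨hinj, hsurj⟩ (fun p => if e p ∈ S then F (e p) else 0)
    (fun g => if g ∈ S then F g else 0) (fun _ => rfl), Fintype.sum_prod_type, Finset.sum_range]
  refine Finset.sum_congr rfl fun l _ => ?_
  simp only [e]
  simp_rw [← hSh l l.isLt]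
  rw [Fintype.sum_ite_mem]

omit [DecidableEq G] in
/-- **THE FOUR-SHEET ANNIHILATOR THEOREM (group form).**  `i : A →* G` injective from a finite abelian group,
`G = ⊔_{l<4} i(A) x^l` with `x^l ∉ i(A)` for `0 < l < 4`, `x i(u) = i(θ u) x`, `x⁴ = i(q)`, `c ∈ A` with `c² = 1` (no hypothesis
`θ c = c` is needed: only the given odd `χ` is used, the equations being weighted by `χ ∘ θ^{−s}`);
`S ⊆ G` with sheets `S_l = {u | i(u) x^l ∈ S}`.  If for every odd `χ` and every `δ < 4` the transformed `4 × 4` system (§2)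
forces `u_0 = 0`, then every `i(c)`-antisymmetric `b : G → ℚ` annihilated by all right translates of `S` is zero.
[cite: Kubota1965, §4 Lemma 2] [cite: Dodson1987, §1.1 (p. 50)] -/
theorem eq_zero_of_fourSheet (i : A →* G) (hi : Function.Injective i) (x : G)
    (hx : ∀ l, 0 < l → l < 4 → ∀ u, i u ≠ x ^ l) (hcov : ∀ g : G, ∃ l, l < 4 ∧ ∃ u, g = i u * x ^ l)
    (θ : MulAut A) (hθ : ∀ u, x * i u = i (θ u) * x) (q : A) (hq : x ^ 4 = i q) {c : A} (hcc : c * c = 1)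
    (S : Finset G) (Sh : ℕ → Finset A) (hSh : ∀ l, l < 4 → ∀ u, u ∈ Sh l ↔ i u * x ^ l ∈ S)
    (hinj : ∀ χ : AddChar (Additive A) ℂ, χ (Additive.ofMul c) = -1 → ∀ δ, δ < 4 → ∀ u : ℕ → ℂ,
      (∀ i₀, i₀ < 4 → ∑ j ∈ Finset.range 4, (if i₀ + j < 4 then (1 : ℂ) else χ (Additive.ofMul q)) *
        (∑ t ∈ Sh j, χ (Additive.ofMul ((θ⁻¹ ^ ((i₀ + j + 4 - δ) % 4)) t))) * u ((i₀ + j + 4 - δ) % 4) = 0) →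
      u 0 = 0)
    (b : G → ℚ) (hb : ∀ g, b (i c * g) = -b g) (hann : ∀ g : G, ∑ s ∈ S, b (s * g) = 0) : b = 0 := by
  have hθ4 := aut_pow_four i hi x θ hθ q hq
  have hθq := aut_fix i hi x θ hθ q hq
  -- the four sheets of `b`
  set β : ℕ → A → ℂ := fun l u => (b (i u * x ^ l) : ℂ) with hβ_def
  have hβ : ∀ l u, β l (c * u) = -β l u := fun l u => by
    simp only [hβ_def, map_mul, mul_assoc, hb, Rat.cast_neg]
  have hsplit := fun g => sum_eq_sum_sheets_four i hi x hx hcov S Sh hSh (fun s => (b (s * g) : ℂ))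
  have hannC : ∀ g : G, ∑ s ∈ S, (b (s * g) : ℂ) = 0 := fun g => by exact_mod_cast hann g
  -- the four-sheet system
  have hsys : ∀ i₀, i₀ < 4 → ∀ w : A,
      ∑ j ∈ Finset.range 4, ∑ t ∈ Sh j, β ((i₀ + j) % 4) (t * (θ ^ j) w * (if i₀ + j < 4 then 1 else q)) = 0 := by
    intro i₀ hi₀ w
    have h := hannC (i w * x ^ i₀)
    rw [hsplit] at h
    rw [← h]
    refine Finset.sum_congr rfl fun j hj => Finset.sum_congr rfl fun t _ => ?_
    rw [Finset.mem_range] at hj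
    simp only [hβ_def]
    congr 1
    -- `i t x^j · i w x^{i₀} = i(t θ^j(w) q^{[i₀+j≥4]}) x^{(i₀+j) mod 4}`
    have e1 : i t * x ^ j * (i w * x ^ i₀) = i (t * (θ ^ j) w) * x ^ (j + i₀) := by
      rw [map_mul, mul_assoc, mul_assoc, ← mul_assoc (x ^ j), pow_mul_eq i x θ hθ, mul_assoc, ← pow_add]
    split_ifs with hlt
    · rw [mul_one, e1, Nat.mod_eq_of_lt hlt, Nat.add_comm j i₀]
    · rw [e1, show j + i₀ = 4 + (i₀ + j) % 4 by omega, pow_add, hq, ← mul_assoc, ← map_mul]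
  have hzero := fourSheet_eq_zero hcc θ hθ4 hθq Sh β hβ hsys hinj
  funext g
  obtain ⟨l, hl, u, rfl⟩ := hcov g
  have := congrFun (hzero l hl) u
  simpa [hβ_def] using this

end Group

end Literature.GroupTheory.FourSheet

end
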